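import Literature.NumberTheory.Automorphic.SatakeParametersGLXiMinors
import Literature.NumberTheory.Automorphic.SatakeTransformGL
import Literature.NumberTheory.Automorphic.HyperspecialUnitaryIwasawaCartan
import HarnessLib

/-!
# Iwasawa versus Cartan for `GL_n`: the Iwasawa exponents of the cosets in `GL_n(𝒪) ϖ^λ GL_n(𝒪)` are dominated by
# `λ` (Bruhat–Tits 1972, Prop. (4.4.4) (i); Macdonald 1995, Ch. V (2.6))

Topic `NumberTheory/Automorphic`; namespace `Literature.NumberTheory.Automorphic` (lane `lit-hodgefound`, Track 2 foundations;
seat `lit-hodgefound-p11`, generation 36, row g36-#11).  THEOREMS ONLY: no definition, no named fact, no instance, no notation.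
The `GL_n` companion, in the tree's `ValuativeRel` setting of `SatakeTransformGL` (`iwasawaExp hϖ g`, `g = u ϖ^{e(g)} k`) and
`SatakeParametersGLXiMinors` (`minorBounded`, `mul_mem_minorBounded`, `mem_minorBounded_mul`), of
`HyperspecialUnitaryIwasawaCartan` (the same statement for the quasi-split unitary group, `Valued` setting), whose
field-independent lemmas (`sum_ite_le_sum_of_injective`, `det_submatrix_last_of_blockTriangular`, `sum_last_eq_sum_ite`,
`eq_of_forall_sum_ite_lt_eq`) are reused.  `SatakeParametersGLIsoProofs` proved the Satake isomorphism for `GL_n` by a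
dimension count «in place of the triangularity argument of Cartier's proof, step (c)»; this file supplies that
triangularity.

## The print

[BruhatTits1972] Prop. (4.4.4) (i) (p. 80): «Si `K.t.K ∩ B̂⁰.t'.K ≠ ∅`, on a `t' ≤ t` (autrement dit `p(t − t') ≥ 0` pour
tout poids dominant `p` …)».  [Macdonald1995] Ch. V (2.6)–(2.7) (for `GL_n(F)`, `K = GL_n(𝒪)`, `N` upper unitriangular):
`K ϖ^λ K ∩ N ϖ^μ K ≠ ∅ ⟹ μ ≤ λ` in the dominance order, i.e. `μ_1 + ⋯ + μ_r ≤ λ_1 + ⋯ + λ_r` for all `r`, with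
`|μ| = |λ|`.  Proof by minors (Macdonald Ch. II §1 / the easy half of elementary divisors): every `r × r` minor of an element of
`K ϖ^λ K · K` has valuation `≤ |ϖ|^{λ_{n-r+1} + ⋯ + λ_n}`, while the lower-right corner minor of the upper triangular
`u ϖ^μ = g k⁻¹` is `ϖ^{μ_{n-r+1} + ⋯ + μ_n}`; and `|det|` gives `|μ| = |λ|`.

## What is formalised (`F` with a `ValuativeRel`; `𝒪[F]` a DVR and `ϖ` uniformizing for §2)

* §1 `prod_valuation_zpow_eq`, **`zpowDiagGL_mem_minorBounded`** (minors of `ϖ^a`, `a ∈ ℤⁿ` antitone),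
  `valuation_det_submatrix_le_of_eq_mul_zpowDiagGL_mul` (minors on `K ϖ^a K · P`, `P` integral).
* §2 **`sum_ite_le_sum_ite_iwasawaExp_of_mem_orbit`** (tail sums: `∑_{i ≥ n-r} a_i ≤ ∑_{i ≥ n-r} e(g)_i` for
  `gK ⊆ K ϖ^a K`), **`sum_iwasawaExp_eq_of_mem_orbit`** (`|e(g)| = |a|`), **`sum_iwasawaExp_head_le_of_mem_orbit`** —
  BRUHAT–TITS (4.4.4) (i) / MACDONALD (2.6) FOR `GL_n`: `∑_{i<r} e(g)_i ≤ ∑_{i<r} a_i` for all `r` — and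
  `iwasawaExp_eq_of_mem_orbit_of_forall_le` (equality case).

## References
* [BruhatTits1972] F. Bruhat, J. Tits, *Groupes réductifs sur un corps local. I*, Publ. Math. IHÉS 41 (1972), (4.4.4).
* [Macdonald1995] I. G. Macdonald, *Symmetric Functions and Hall Polynomials*, 2nd ed. (1995), Ch. II §1, Ch. V (2.6)–(2.7).
* [CartierCorvallis1979] P. Cartier, *Representations of 𝔭-adic groups: a survey*, PSPM 33.1 (1979), §IV, proof of
  Thm. 4.1, step (c).
-/

noncomputable section

open scoped MatrixGroups
open ValuativeRel Matrix Finset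

namespace Literature.NumberTheory.Automorphic

open Literature.NumberTheory.Automorphic.CartanUnique Literature.NumberTheory.Automorphic.HermitianLattice

variable {F : Type*} [Field F] [ValuativeRel F] {n : ℕ}

/-! ## §1 The minors of `ϖ^a` (`a ∈ ℤⁿ` antitone) and of `K ϖ^a K · P` -/

/-- `∏_i v^{f i} = v^{∑_i f i}` for `v ≠ 0` in the value group. [cite: Macdonald1995, Ch. II §1] -/
theorem prod_valuation_zpow_eq {ι : Type*} (s : Finset ι) {v : ValueGroupWithZero F} (hv : v ≠ 0) (f : ι → ℤ) :
    ∏ i ∈ s, v ^ f i = v ^ ∑ i ∈ s, f i := by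
  classical
  induction s using Finset.induction_on with
  | empty => simp
  | insert a s ha ih => rw [Finset.prod_insert ha, Finset.sum_insert ha, ih, zpow_add₀ hv]

/-- **The minors of `ϖ^a`** (`a ∈ ℤⁿ` antitone, `|ϖ| ≤ 1`): every `r × r` minor of `diag(ϖ^{a_i})` with injective column
selection has valuation `≤ |ϖ|^{∑_{i ≥ n-r} a_i}` (it is `0` or `± ∏_j ϖ^{a_{c j}}`; the integral case `a ∈ ℕⁿ` is
`piPow_mem_minorBounded`). [cite: Macdonald1995, Ch. II §1] -/
theorem zpowDiagGL_mem_minorBounded {ϖ : F} (hϖ0 : ϖ ≠ 0) (hϖ1 : valuation F ϖ ≤ 1) {a : Fin n → ℤ} (ha : Antitone a)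
    (r : ℕ) :
    ((zpowDiagGL hϖ0 a : GL (Fin n) F) : Matrix (Fin n) (Fin n) F) ∈
      minorBounded n r (valuation F ϖ ^ (∑ i : Fin n, if n ≤ (i : ℕ) + r then a i else 0)) := by
  classical
  have hv0 : valuation F ϖ ≠ 0 := (Valuation.ne_zero_iff _).2 hϖ0
  intro ρ c hc
  rw [coe_zpowDiagGL, Matrix.det_apply']
  refine Valuation.map_sum_le _ fun τ _ => ?_
  have hterm : valuation F (∏ i, (Matrix.diagonal fun i => ϖ ^ a i).submatrix ρ c (τ i) i) ≤
      valuation F ϖ ^ (∑ i : Fin n, if n ≤ (i : ℕ) + r then a i else 0) := by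
    rw [map_prod]
    calc ∏ i, valuation F ((Matrix.diagonal fun i => ϖ ^ a i).submatrix ρ c (τ i) i)
        ≤ ∏ i, valuation F ϖ ^ a (c i) := by
          refine Finset.prod_le_prod' fun i _ => ?_
          rw [Matrix.submatrix_apply, Matrix.diagonal_apply]
          split_ifs with h
          · rw [h, map_zpow₀]
          · rw [map_zero]; exact zero_le
      _ = valuation F ϖ ^ ∑ i, a (c i) := prod_valuation_zpow_eq _ hv0 _
      _ ≤ valuation F ϖ ^ (∑ i : Fin n, if n ≤ (i : ℕ) + r then a i else 0) :=
          zpow_le_zpow_right_of_le_one₀ (zero_lt_iff.2 hv0) hϖ1 (sum_ite_le_sum_of_injective ha hc)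
  have hsign : valuation F (((Equiv.Perm.sign τ : ℤˣ) : ℤ) : F) ≤ 1 := by
    rcases Int.units_eq_one_or (Equiv.Perm.sign τ) with h | h
    · rw [h, Units.val_one, Int.cast_one, map_one]
    · rw [h, Units.val_neg, Units.val_one, Int.cast_neg, Int.cast_one, Valuation.map_neg, map_one]
  rw [map_mul]
  calc valuation F (((Equiv.Perm.sign τ : ℤˣ) : ℤ) : F) *
      valuation F (∏ i, (Matrix.diagonal fun i => ϖ ^ a i).submatrix ρ c (τ i) i)
      ≤ 1 * valuation F ϖ ^ (∑ i : Fin n, if n ≤ (i : ℕ) + r then a i else 0) := mul_le_mul' hsign hterm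
    _ = _ := one_mul _

/-- **Minors on `K ϖ^a K · P`**: for `k₁, k₂ ∈ GL_n(𝒪)`, `P` integral and `a ∈ ℤⁿ` antitone, every `r × r` minor of
`k₁ ϖ^a k₂ P` with injective column selection has valuation `≤ |ϖ|^{∑_{i ≥ n-r} a_i}`. [cite: Macdonald1995, Ch. II §1] -/
theorem valuation_det_submatrix_le_of_eq_mul_zpowDiagGL_mul {ϖ : F} (hϖ0 : ϖ ≠ 0) (hϖ1 : valuation F ϖ ≤ 1)
    {a : Fin n → ℤ} (ha : Antitone a) {k₁ k₂ : GL (Fin n) F} (hk₁ : k₁ ∈ glInt n F) (hk₂ : k₂ ∈ glInt n F)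
    {P b : Matrix (Fin n) (Fin n) F} (hP : IsIntegralMatrix P)
    (h : b = (k₁ : Matrix (Fin n) (Fin n) F) * (zpowDiagGL hϖ0 a : GL (Fin n) F) * k₂ * P) {r : ℕ}
    (ρ c : Fin r → Fin n) (hc : Function.Injective c) :
    valuation F (b.submatrix ρ c).det ≤ valuation F ϖ ^ (∑ i : Fin n, if n ≤ (i : ℕ) + r then a i else 0) := by
  have hmem : b ∈ minorBounded n r (valuation F ϖ ^ (∑ i : Fin n, if n ≤ (i : ℕ) + r then a i else 0)) := by
    rw [h]
    exact mul_mem_minorBounded (mul_mem_minorBounded (mem_minorBounded_mul (isIntegralMatrix_of_mem_glInt hk₁)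
      (zpowDiagGL_mem_minorBounded hϖ0 hϖ1 ha r)) (isIntegralMatrix_of_mem_glInt hk₂)) hP
  exact hmem ρ c hc

/-! ## §2 Bruhat–Tits (4.4.4) (i) / Macdonald (2.6) for `GL_n` -/

variable [IsDiscreteValuationRing 𝒪[F]] {ϖ : F}

omit [IsDiscreteValuationRing 𝒪[F]] in
/-- Head and tail sums are complementary: `∑_{i<r} f_i + ∑_{i ≥ r} f_i = ∑_i f_i` (`r ≤ n`). [cite: Macdonald1995, Ch. V (2.6)] -/
theorem sum_ite_lt_add_sum_ite_le (f : Fin n → ℤ) {r : ℕ} (hr : r ≤ n) :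
    (∑ i : Fin n, if (i : ℕ) < r then f i else 0) + (∑ i : Fin n, if n ≤ (i : ℕ) + (n - r) then f i else 0) =
      ∑ i : Fin n, f i := by
  rw [← Finset.sum_add_distrib]
  refine Finset.sum_congr rfl fun i _ => ?_
  by_cases h : (i : ℕ) < r
  · rw [if_pos h, if_neg (by omega), add_zero]
  · rw [if_neg h, if_pos (by have := i.isLt; omega), zero_add]

/-- **Tail sums**: if `gK ⊆ K ϖ^a K` (`K = GL_n(𝒪)`, `a ∈ ℤⁿ` antitone) then `∑_{i ≥ n-r} a_i ≤ ∑_{i ≥ n-r} e(g)_i` for every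
`r ≤ n`, `e(g) = iwasawaExp` (compare the lower-right `r × r` corner minor `ϖ^{∑_{i ≥ n-r} e_i}` of `u ϖ^{e} = g k⁻¹` with the
bound on all `r × r` minors of `K ϖ^a K · K`). [cite: BruhatTits1972, (4.4.4) (i)] [cite: Macdonald1995, Ch. V (2.6)] -/
theorem sum_ite_le_sum_ite_iwasawaExp_of_mem_orbit (hϖ : IsUniformizingElement ϖ) {a : Fin n → ℤ} (ha : Antitone a)
    {g : GL (Fin n) F}
    (hg : (g : GL (Fin n) F ⧸ glInt n F) ∈ MulAction.orbit (glInt n F) (zpowDiagGL hϖ.ne_zero a : GL (Fin n) F ⧸ glInt n F))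
    {r : ℕ} (hr : r ≤ n) :
    (∑ i : Fin n, if n ≤ (i : ℕ) + r then a i else 0) ≤ ∑ i : Fin n, if n ≤ (i : ℕ) + r then iwasawaExp hϖ g i else 0 := by
  have hv0 : valuation F ϖ ≠ 0 := (Valuation.ne_zero_iff _).2 hϖ.ne_zero
  obtain ⟨A, hA, B, hB, hgAB⟩ := (heckeAlgebra.coe_mem_orbit_coe_iff (glInt n F) _ _).1 hg
  obtain ⟨u, hu, k, hk, hutk⟩ := iwasawaExp_spec hϖ g
  set e := iwasawaExp hϖ g with he
  -- the upper triangular `b = u ϖ^e = g k⁻¹ = A ϖ^a B k⁻¹`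
  have hbk : u * zpowDiagGL hϖ.ne_zero e = g * k⁻¹ := by rw [hutk, mul_inv_cancel_right]
  have hbT : ((u * zpowDiagGL hϖ.ne_zero e : GL (Fin n) F) : Matrix (Fin n) (Fin n) F).BlockTriangular id :=
    blockTriangular_mul_zpowDiagGL hu hϖ.ne_zero e
  have hmat : ((u * zpowDiagGL hϖ.ne_zero e : GL (Fin n) F) : Matrix (Fin n) (Fin n) F) =
      (A : Matrix (Fin n) (Fin n) F) * (zpowDiagGL hϖ.ne_zero a : GL (Fin n) F) * B * ((k⁻¹ : GL (Fin n) F) : Matrix (Fin n) (Fin n) F) := by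
    rw [hbk, hgAB, Units.val_mul, Units.val_mul, Units.val_mul]
  have h1 := valuation_det_submatrix_le_of_eq_mul_zpowDiagGL_mul hϖ.ne_zero hϖ.valuation_le_one ha hA hB
    (isIntegralMatrix_inv_of_mem_glInt hk) hmat
    (fun j : Fin r => (⟨n - r + j, by omega⟩ : Fin n)) (fun j : Fin r => (⟨n - r + j, by omega⟩ : Fin n))
    (fun j j' hjj' => by simp only [Fin.mk.injEq] at hjj'; exact Fin.ext (by omega))
  rw [det_submatrix_last_of_blockTriangular hbT hr] at h1
  simp_rw [mul_zpowDiagGL_apply_self hu hϖ.ne_zero e] at h1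
  rw [map_prod] at h1
  simp_rw [map_zpow₀] at h1
  rw [prod_valuation_zpow_eq _ hv0, sum_last_eq_sum_ite hr] at h1
  exact (zpow_le_zpow_iff_right_of_lt_one₀ (zero_lt_iff.2 hv0) hϖ.valuation_lt_one).1 h1

/-- **`|e(g)| = |a|`** for `gK ⊆ K ϖ^a K`: the total Iwasawa exponent is the valuation of the determinant.
[cite: Macdonald1995, Ch. V (2.6)] -/
theorem sum_iwasawaExp_eq_of_mem_orbit (hϖ : IsUniformizingElement ϖ) {a : Fin n → ℤ} {g : GL (Fin n) F}
    (hg : (g : GL (Fin n) F ⧸ glInt n F) ∈ MulAction.orbit (glInt n F) (zpowDiagGL hϖ.ne_zero a : GL (Fin n) F ⧸ glInt n F)) :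
    ∑ i, iwasawaExp hϖ g i = ∑ i, a i := by
  have hv0 : valuation F ϖ ≠ 0 := (Valuation.ne_zero_iff _).2 hϖ.ne_zero
  obtain ⟨A, hA, B, hB, hgAB⟩ := (heckeAlgebra.coe_mem_orbit_coe_iff (glInt n F) _ _).1 hg
  obtain ⟨u, hu, k, hk, hutk⟩ := iwasawaExp_spec hϖ g
  have hdetu : (u : Matrix (Fin n) (Fin n) F).det = 1 := by
    rw [mem_upperUnitriangular_iff] at hu
    rw [Matrix.det_of_upperTriangular hu.1]
    exact Finset.prod_eq_one fun i _ => hu.2 i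
  have h1 : valuation F (g : Matrix (Fin n) (Fin n) F).det = valuation F ϖ ^ ∑ i, iwasawaExp hϖ g i := by
    conv_lhs => rw [hutk]
    rw [Units.val_mul, Units.val_mul, Matrix.det_mul, Matrix.det_mul, map_mul, map_mul,
      hdetu, map_one, one_mul, valuation_det_eq_one_of_mem_glInt hk, mul_one,
      coe_zpowDiagGL, Matrix.det_diagonal, map_prod]
    simp_rw [map_zpow₀]
    exact prod_valuation_zpow_eq _ hv0 _
  have h2 : valuation F (g : Matrix (Fin n) (Fin n) F).det = valuation F ϖ ^ ∑ i, a i := by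
    rw [hgAB, Units.val_mul, Units.val_mul, Matrix.det_mul, Matrix.det_mul, map_mul, map_mul,
      valuation_det_eq_one_of_mem_glInt hA, one_mul, valuation_det_eq_one_of_mem_glInt hB, mul_one, coe_zpowDiagGL,
      Matrix.det_diagonal, map_prod]
    simp_rw [map_zpow₀]
    exact prod_valuation_zpow_eq _ hv0 _
  rw [h1] at h2
  exact (zpow_right_strictAnti₀ (zero_lt_iff.2 hv0) hϖ.valuation_lt_one).injective h2

/-- **BRUHAT–TITS (4.4.4) (i) / MACDONALD (2.6) FOR `GL_n`**: if the coset `gK` lies in `K ϖ^a K` (`K = GL_n(𝒪)`, `a ∈ ℤⁿ`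
antitone), then the Iwasawa exponents `e(g)` (`g ∈ N ϖ^{e(g)} K`) are DOMINATED by `a`: `∑_{i<r} e(g)_i ≤ ∑_{i<r} a_i` for all
`r` — so `x^μ` occurs in `𝒮(T_{ϖ^a})` (`satakeTransform_doubleCosetOperator`) only for `μ ≤ a`.
[cite: BruhatTits1972, (4.4.4) (i)] [cite: Macdonald1995, Ch. V (2.6)] [cite: CartierCorvallis1979, §IV, proof of Thm. 4.1] -/
theorem sum_iwasawaExp_head_le_of_mem_orbit (hϖ : IsUniformizingElement ϖ) {a : Fin n → ℤ} (ha : Antitone a)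
    {g : GL (Fin n) F}
    (hg : (g : GL (Fin n) F ⧸ glInt n F) ∈ MulAction.orbit (glInt n F) (zpowDiagGL hϖ.ne_zero a : GL (Fin n) F ⧸ glInt n F))
    (r : ℕ) :
    (∑ i : Fin n, if (i : ℕ) < r then iwasawaExp hϖ g i else 0) ≤ ∑ i : Fin n, if (i : ℕ) < r then a i else 0 := by
  wlog hr : r ≤ n generalizing r
  · have h := this n le_rfl
    have h1 : ∀ f : Fin n → ℤ, (∑ i : Fin n, if (i : ℕ) < r then f i else 0) = ∑ i : Fin n, if (i : ℕ) < n then f i else 0 :=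
      fun f => Finset.sum_congr rfl fun i _ => by rw [if_pos (by omega), if_pos i.isLt]
    rw [h1, h1]
    exact h
  have htail := sum_ite_le_sum_ite_iwasawaExp_of_mem_orbit hϖ ha hg (Nat.sub_le n r)
  have htot := sum_iwasawaExp_eq_of_mem_orbit hϖ hg
  have he := sum_ite_lt_add_sum_ite_le (iwasawaExp hϖ g) hr
  have ha' := sum_ite_lt_add_sum_ite_le a hr
  omega

/-- **Equality case**: if moreover `∑_{i<r} a_i ≤ ∑_{i<r} e(g)_i` for all `r`, then `e(g) = a`. [cite: BruhatTits1972, (4.4.4) (i)] -/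
theorem iwasawaExp_eq_of_mem_orbit_of_forall_le (hϖ : IsUniformizingElement ϖ) {a : Fin n → ℤ} (ha : Antitone a)
    {g : GL (Fin n) F}
    (hg : (g : GL (Fin n) F ⧸ glInt n F) ∈ MulAction.orbit (glInt n F) (zpowDiagGL hϖ.ne_zero a : GL (Fin n) F ⧸ glInt n F))
    (hle : ∀ r : ℕ, (∑ i : Fin n, if (i : ℕ) < r then a i else 0) ≤ ∑ i : Fin n, if (i : ℕ) < r then iwasawaExp hϖ g i else 0) :
    iwasawaExp hϖ g = a :=
  eq_of_forall_sum_ite_lt_eq fun r => le_antisymm (sum_iwasawaExp_head_le_of_mem_orbit hϖ ha hg r) (hle r)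

end Literature.NumberTheory.Automorphic

end
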